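import Summits.QuantumFields.QCD.Theses.PauliWegnerSea
import Summits.QuantumFields.QCD.Theorems.TiltedFlatness.Negative.TwoWellFloor
import Summits.QuantumFields.QCD.Theorems.TiltedFlatness.Negative.MasslessKernel
import Literature.Analysis.Approximation.CarberyWrightProofs
import Literature.Barriers.QuantumFields.UnitaryHaarSmallBall
import Literature.MathematicalPhysics.QuantumFieldTheory.StrongCouplingActivities

/-!
# Line `cayley-chart-averaging` — skeleton for crux `TiltedFlatness` (stmt-QuantumFields-14070)

Crux: `Summit.QuantumFields.QCD.Theses.PauliWegnerSea.TiltedFlatness` (rev 4 = C′, rank-3 crux of route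
`PauliWegnerSea`). Idea card `Cruxes/TiltedFlatness/Ideas/cayley-chart-averaging.md` (crux-ideate r1,
ideator 3; triage r1-1/2/3: pass). Crux-plan seat
`planner-cruxplan-stmt-QuantumFields-14070-cayley-chart-averagi-0`, 2026-08-16.

## The line in one paragraph

The crux is `(R1) + sandwich` (§0, the PROVED trunk `cruxOfR1Density_holds :
HaarRelativeSmallBalls → TiltDensityBound → TiltedFlatness` (= `tiltedFlatness_of_R1_density`), copied from
`Lines/R1DensityReduction.lean` because Cruxes modules are not built on the farm). (R1) = β = 0 relative
small balls `Haar{F ≤ ε F(W₀)} ≤ C ε^c` for the star-link sea `F = |det diracMatrix(refit ·) mq|`. This line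
gets (R1) from the tree's PROVED convex-body theorem
`Literature.Analysis.Approximation.CarberyWright.supSublevelBound_holds` (Carbery–Wright Thm 2 at q = ∞ =
Brudnyi–Ganzburg; absolute constant `16e²`) through RATIONAL charts of the group:

* chart (§1): `y ∈ ℝ⁹ ↦ p(g · cay(uHerm y)) ∈ SU(3)`, `cay(H) = (1+iH)(1−iH)⁻¹` (Cayley),
  `p(M) = M·diag(conj det M, 1, 1)` (determinant-phase correction; `p` is the identity on `SU(3)` and is
  LEFT-`SU(3)`-EQUIVARIANT, `p(wM) = w·p(M)`), centre `g ∈ U(3)`; one chart per edge (`chartCfg`);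
* averaging identity (Jacobian-free): for the probability `μ` = law of `(p∘cay∘uHerm)(y_e)_e`,
  `y ~ Leb(B₁)^{⊗E}`, `Haar = ∫ (L_W)_* μ dHaar(W)` on `SU(3)^E` (tree `haarAverageTranslate_holds`, §0;
  equivariance turns `W·h` into the chart centred at `W`) — so `Haar{A} = ∫ dHaar(W) Leb^{⊗}{y : chartCfg W y ∈ A}`;
* in a chart the squared sea times the two-sided bounded weight `∏_e |det(1 − i·uHerm y_e)|^N ∈ [1, 8^{Nk}]`
  is a REAL POLYNOMIAL of total degree `≤ D(N_f)` in the `9k ≤ 144` star coordinates (`ChartPolynomiality`,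
  row-multilinearity of `det`; `L`-, outside-, mass-independent degree) on the CONVEX BODY `B₁^k`
  (`uOpNorm ≤ 1` per link), so the fibre small-ball volume is a polynomial sublevel volume and
  `supSublevelBound_holds` (scaled: `ConvexSublevel`) bounds it by `C·9k·η^{1/D}` — PROVIDED the chart's own
  sup is comparable to the global sup;
* chart-sup comparability (`ChartSupChain`): join the centre `g` to the maximiser `W*` by the 7-step path
  `g·exp(ijH₀/7)` (`exists_uCoords_eq`, `norm_expHermUnitary_sub_le`, PROVED in
  `Barriers/QuantumFields/UnitaryHaarSmallBall.lean`); consecutive charts overlap in the IMAGE of the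
  concentric sub-ball `B_{1/6}` (local surjectivity of `cay` on `‖V − 1‖ ≤ 1` + `‖cay H − 1‖ ≤ 2‖H‖`), and the
  REMEZ FORM of the same convex-body theorem (`ConvexSublevel` (ii), concentric balls, volume ratio `6^{-9k}`
  by homogeneity — no transition Jacobian) passes suprema chart → chart:
  `sup_chart F ≥ κ(N_f) · sup F`.
Then `{F∘chart ≤ εF(W₀)} ⊆ {Q ≤ (ε² 8^{Nk}/κ²)·sup Q}` and (R1) follows with `c = 2/D` (`stub_assembleR1`);
`TiltDensityBound` (`stub_density`, shared verbatim with the torus line) finishes via the trunk.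

## Stubs (the ONLY `sorry`s), hardest first

* `stub_chartPoly` (L; HARDEST — `MvPolynomial` bookkeeping of row-multilinearity for the `3072 N_f`-row
  determinant with `≤ 384 N_f` chart-dependent rows): `ChartPolynomiality`.
* `stub_assembleR1` (M–L; measure plumbing + one engine call): geometry → polynomiality → `ConvexSublevel` →
  `ChartSupChain` → `HaarRelativeSmallBalls`.
* `stub_chain` (M): geometry → polynomiality → `ConvexSublevel` → `ChartSupChain`.
* `stub_density` (M): `TiltDensityBound` (Lipschitz sandwich; `p₀ = 9k ≤ 144`).
* `stub_chartGeometry` (M): `CayleyChartGeometry` (G0a–G5: membership, origin, equivariance, weight pinching,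
  local surjectivity, Lipschitz at `0`, unitarity, continuity of the single-link chart).
* `stub_convexSublevel` (S–M): `ConvexSublevel` = `supSublevelBound_holds` rescaled to arbitrary volume +
  its Remez form.

## Composition

`TiltedFlatness_of : TiltedFlatness` (BY NAME, sorry-free outside the stubs):
`cruxOfR1Density_holds (stub_assembleR1 geo poly sub (stub_chain geo poly sub)) stub_density`.

## Changes w.r.t. the idea card (triage sharpenings acted on)

* `DetPhaseSplit` (push `Haar_{U(3)} → Haar_{SU(3)}`) is DROPPED: `p` is composed INTO the chart and is
  `SU(3)`-equivariant, so the averaging identity is applied on `SU(3)^E` itself (any probability `μ`);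
  chart centres in `U(3)` survive only inside the chain. One stub and one uniqueness-of-Haar argument fewer.
* r1-1: `ChartPolynomiality` is stated in the multi-link / `N_f`-flavour PRODUCT form the assembler consumes
  (variables `{e // star e} × (Fin 3 × Fin 3)`, weight `∏_e |det(1 − i uHerm y_e)|^N`); the chain is kept
  (load-bearing).
* r1-2: no transition-Jacobian stub is needed — the Remez step compares CONCENTRIC balls in one chart's own
  coordinates; the overlap is used only as a set inclusion.
* r1-2/r1-3 (`U(N)`-vs-`SU(3)` Haar ball): `stub_density` may use the `U(3)` net of
  `haar_unitaryOpBall_ge`'s proof pushed into `SU(3)` by `p` (`‖p(u) − p(v)‖ ≤ 4‖u − v‖`, `p|SU(3) = id`: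
  a `4ρ`-net of `SU(3)` of size `((2π+ρ)/ρ)^9`), or the ball-free word-fibre argument of the torus line —
  the statement is shared verbatim with that line.
* r1-3: the averaging identity is needed for INDICATORS; `stub_assembleR1` extends
  `haarAverageTranslate_holds` (continuous `f`) to bounded Borel `f` (same Fubini proof) — recorded in its
  docstring, not a separate stub.

## Disproof.lean used (cdisprove cycle 1 on 14070: NO KILL, `C′` believed true)

No `_false_without_<H>` theorem exists for 14070, so no stub is obliged to use a named `H`. Checked against
the landed negatives (imported here): `Negative/TwoWellFloor` (β-uniform (b) false — this line proves (b′)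
with the `(1+β)^p` of `TiltDensityBound`, `p = p₀/c`), `Negative/MasslessKernel` (`F ≡ 0` fibres at `m = 0` —
honoured by the guards `0 < F W₀` in (R1) and `0 < M` in the crux; `ChartSupChain` is homogeneous and holds
trivially when `F ≡ 0`), and Disproof §7.2/§9 (`not_tiltedFlatnessNoLossA`: loss in (a) necessary — the
trunk gives `p_a = p₀/c > 0`; `not_tiltedFlatnessUniformInNf`: constants must depend on `N_f` — here
`c = 2/D(N_f)`, `κ = κ(N_f)`). Disproof §8's soft architecture (P1 untilt + P2 finite vanishing order) is
made EFFECTIVE: P2's non-constructive `k₀` becomes the chart degree `D`, P1 is `stub_density`.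
-/

noncomputable section

namespace Summit.QuantumFields.QCD.Cruxes.TiltedFlatness.CayleyChartAveraging

open scoped BigOperators Real Matrix.Norms.L2Operator Classical
open MeasureTheory Set Filter
open Literature.MathematicalPhysics.QuantumFieldTheory Literature.MathematicalPhysics.QuantumLattice
  Literature.Probability.LatticeModels Literature.Barriers.QuantumFields
open Summit.QuantumFields.QCD.Theses.PauliWegnerSea

/-! ## §0  Trunk — verbatim copy of the PROVED part of `Lines/R1DensityReduction.lean`

(crux-ideate r1, ideator 3; re-checked rc 0 / 0 sorry / axioms {propext, Classical.choice, Quot.sound} by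
all three triagers). Copied, not imported, because `Summits.…Cruxes.…` modules are not built on the farm
(`lean check`: `unbuilt`). When they are, replace this section by
`import Summits.QuantumFields.QCD.Cruxes.TiltedFlatness.Lines.R1DensityReduction` +
`open Summit.QuantumFields.QCD.Cruxes.TiltedFlatness.R1DensityReduction`. -/

/-- (R1) GLOBAL RELATIVE SMALL BALLS under the untilted product Haar law, uniformly in masses,
volume, outside and sites: `Haar{F ≤ ε F(W₀)} ≤ C ε^c` for every `W₀` with `F(W₀) > 0` (in particular
the argmax when `F ≢ 0`; if `F ≡ 0` on the fibre then `M = 0`, clause (b′) is guarded and (a) is `0 ≤ 0`).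
This is the only genuinely analytic input of the crux (see `CruxOfR1Density`). -/
def HaarRelativeSmallBalls : Prop :=
  ∀ Nf : ℕ, ∃ C c : ℝ, 0 < C ∧ 0 < c ∧ ∀ mq : Fin Nf → ℝ, (∀ f, -2 ≤ mq f ∧ mq f ≤ 2) →
    ∀ (L : ℕ) [NeZero L], 4 ≤ L →
    ∀ (U : GaugeConfig 4 L (Matrix.specialUnitaryGroup (Fin 3) ℂ)) (x y : TorusSite 4 L),
    let star : Edge 4 L → Prop := fun e => e.1 = x ∨ Site.shift e.1 e.2 = x ∨ e.1 = y ∨ Site.shift e.1 e.2 = y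
    let refit : GaugeConfig 4 L (Matrix.specialUnitaryGroup (Fin 3) ℂ) →
        GaugeConfig 4 L (Matrix.specialUnitaryGroup (Fin 3) ℂ) := fun W e => if star e then W e else U e
    let F : GaugeConfig 4 L (Matrix.specialUnitaryGroup (Fin 3) ℂ) → ℝ :=
      fun W => ‖(diracMatrix (refit W) mq).det‖
    let haar : Measure (GaugeConfig 4 L (Matrix.specialUnitaryGroup (Fin 3) ℂ)) :=
      Measure.pi fun _ => haarProbability (Matrix.specialUnitaryGroup (Fin 3) ℂ)
    ∀ (W₀ : GaugeConfig 4 L (Matrix.specialUnitaryGroup (Fin 3) ℂ)), 0 < F W₀ → ∀ ε : ℝ, 0 < ε →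
      (haar {W | F W ≤ ε * F W₀}).toReal ≤ C * ε ^ c

/-- TILT DENSITY BOUND (the Lipschitz/Taylor sandwich; not this card's lever): the star-conditional
Wilson law has density `wt/Z ≤ C (1+β)^p` against product Haar, uniformly in the outside. -/
def TiltDensityBound : Prop :=
  ∃ C p : ℝ, 0 < C ∧ ∀ β : ℝ, 0 ≤ β → ∀ (L : ℕ) [NeZero L], 4 ≤ L →
    ∀ (U : GaugeConfig 4 L (Matrix.specialUnitaryGroup (Fin 3) ℂ)) (x y : TorusSite 4 L),
    let star : Edge 4 L → Prop := fun e => e.1 = x ∨ Site.shift e.1 e.2 = x ∨ e.1 = y ∨ Site.shift e.1 e.2 = y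
    let refit : GaugeConfig 4 L (Matrix.specialUnitaryGroup (Fin 3) ℂ) →
        GaugeConfig 4 L (Matrix.specialUnitaryGroup (Fin 3) ℂ) := fun W e => if star e then W e else U e
    let wt : GaugeConfig 4 L (Matrix.specialUnitaryGroup (Fin 3) ℂ) → ℝ :=
      fun W => Real.exp (-(β * wilsonAction (fundamentalRep (Fin 3)) (refit W)))
    let haar : Measure (GaugeConfig 4 L (Matrix.specialUnitaryGroup (Fin 3) ℂ)) :=
      Measure.pi fun _ => haarProbability (Matrix.specialUnitaryGroup (Fin 3) ℂ)
    let Z : ℝ := ∫ W, wt W ∂haar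
    ∀ W, wt W / Z ≤ C * (1 + β) ^ p

/-- EXACT AVERAGING IDENTITY `Haar = Haar ∗ μ` (right-invariance + Fubini; no Jacobian, no Weyl
formula): for ANY probability measure `μ` on a compact group and continuous `f`,
`∫ f dHaar = ∫ (∫ f(g·h) dμ(h)) dHaar(g)`.  Applied with `μ` = law of the word
`exp(θ₁X₁)⋯exp(θ_dX_d)`, `θ ∼` Lebesgue on `[0,2π]^d`: every fibre `g·(word image) = G` sees the
GLOBAL supremum of `F`, and `F`, `wilsonAction` restricted to a fibre are trigonometric polynomials. -/
def HaarAverageTranslate : Prop :=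
  ∀ (G : Type*) [Group G] [TopologicalSpace G] [IsTopologicalGroup G] [CompactSpace G]
    [SecondCountableTopology G] [MeasurableSpace G] [BorelSpace G] (μ : Measure G)
    [IsProbabilityMeasure μ] (f : G → ℝ),
    Continuous f →
      ∫ g, f g ∂(haarProbability G) = ∫ g, (∫ h, f (g * h) ∂μ) ∂(haarProbability G)

/-- `HaarAverageTranslate` PROVED (Fubini + right invariance of the Haar probability of a compact
group, `haarProbability.instIsMulRightInvariant` of `StrongCouplingActivities`): the exact averaging
identity behind both cards needs no Jacobian and no Weyl integration formula. -/
theorem haarAverageTranslate_holds : HaarAverageTranslate := by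
  intro G _ _ _ _ _ _ _ μ _ f hf
  obtain ⟨C, hC⟩ : ∃ C, ∀ x, ‖f x‖ ≤ C := by
    obtain ⟨C, hC⟩ := isCompact_univ.exists_bound_of_continuousOn (f := f) hf.continuousOn
    exact ⟨C, fun x => hC x (Set.mem_univ x)⟩
  have hcont : Continuous (fun p : G × G => f (p.1 * p.2)) := hf.comp continuous_mul
  have hint : Integrable (Function.uncurry fun g h => f (g * h)) ((haarProbability G).prod μ) := by
    refine Integrable.mono' (integrable_const C) hcont.aestronglyMeasurable ?_
    exact Filter.Eventually.of_forall fun p => hC _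
  calc ∫ g, f g ∂(haarProbability G)
      = ∫ h, (∫ g, f g ∂(haarProbability G)) ∂μ := by simp
    _ = ∫ h, (∫ g, f (g * h) ∂(haarProbability G)) ∂μ := by
        congr 1; ext h; exact (integral_mul_right_eq_self f h).symm
    _ = ∫ g, (∫ h, f (g * h) ∂μ) ∂(haarProbability G) := (integral_integral_swap hint).symm

/-- ABSTRACT FORM OF `CruxOfR1Density`, PROVED: on a compact space with a finite measure `μ`, a
continuous amplitude `F ≥ 0`, a continuous positive weight `w` with DENSITY BOUND `w/Z ≤ K`
(`Z = ∫ w`), and RELATIVE SMALL BALLS `μ{F ≤ ε F(x₀)} ≤ C_R ε^c` for every `x₀` with `F(x₀) > 0`: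
(a) `F(x₀) ≤ 2(2KC_R+1)^{1/c} · M` for every `x₀`, `M = ∫Fw/Z` (flatness WITHOUT any local Remez
lemma), and (b) `∫ 1{F ≤ εM} w / Z ≤ K C_R ε^c`.  With `K = C_D(1+β)^{p₀}` this is the crux with
`p = max(p₀/c, p₀)`. -/
theorem flatness_and_smallBalls_of_anticoncentration
    {X : Type*} [TopologicalSpace X] [CompactSpace X] [MeasurableSpace X] [OpensMeasurableSpace X]
    (μ : Measure X) [IsFiniteMeasure μ] {F w : X → ℝ} (hF : Continuous F) (hw : Continuous w)
    (hF0 : ∀ x, 0 ≤ F x) (hw0 : ∀ x, 0 ≤ w x) {K C_R c : ℝ} (hK : 0 ≤ K) (hCR : 0 ≤ C_R) (hc : 0 < c)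
    (hZ : 0 < ∫ y, w y ∂μ) (hdens : ∀ x, w x ≤ K * ∫ y, w y ∂μ)
    (hR1 : ∀ x₀, 0 < F x₀ → ∀ ε : ℝ, 0 < ε → (μ {x | F x ≤ ε * F x₀}).toReal ≤ C_R * ε ^ c) :
    (∀ x₀, F x₀ ≤ 2 * (2 * K * C_R + 1) ^ (1 / c) * ((∫ x, F x * w x ∂μ) / ∫ y, w y ∂μ)) ∧
    (0 < (∫ x, F x * w x ∂μ) / (∫ y, w y ∂μ) → ∀ ε : ℝ, 0 < ε →
      (∫ x, (if F x ≤ ε * ((∫ x, F x * w x ∂μ) / ∫ y, w y ∂μ) then (1 : ℝ) else 0) * w x ∂μ) /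
          (∫ y, w y ∂μ) ≤ K * C_R * ε ^ c) := by
  set Z : ℝ := ∫ y, w y ∂μ with hZdef
  have hwi : Integrable w μ := Summit.QuantumFields.QCD.Theorems.TiltedFlatnessNegative.integrable_of_continuous hw
  have hFwi : Integrable (fun x => F x * w x) μ :=
    Summit.QuantumFields.QCD.Theorems.TiltedFlatnessNegative.integrable_of_continuous (hF.mul hw)
  -- the weighted mass of a closed sublevel set `{F ≤ t}` is at most `K Z μ{F ≤ t}`
  have hmass : ∀ t : ℝ, ∫ x in {x | F x ≤ t}, w x ∂μ ≤ K * Z * (μ {x | F x ≤ t}).toReal := by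
    intro t
    have hmeas : MeasurableSet {x | F x ≤ t} := (isClosed_le hF continuous_const).measurableSet
    calc ∫ x in {x | F x ≤ t}, w x ∂μ ≤ ∫ x in {x | F x ≤ t}, K * Z ∂μ := by
          refine setIntegral_mono_on hwi.integrableOn (integrableOn_const) hmeas fun x _ => ?_
          exact hdens x
      _ = K * Z * (μ {x | F x ≤ t}).toReal := by
          rw [setIntegral_const, smul_eq_mul, mul_comm]; rfl
  by_cases hX : Nonempty X
  swap
  · haveI : IsEmpty X := not_nonempty_iff.mp hX
    refine ⟨fun x₀ => (IsEmpty.false x₀).elim, fun hM ε hε => ?_⟩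
    simp [integral_of_isEmpty] at hM
  obtain ⟨xm, -, hxm⟩ := isCompact_univ.exists_isMaxOn univ_nonempty hF.continuousOn
  have hFmax : ∀ x, F x ≤ F xm := fun x => hxm (mem_univ x)
  -- `M ≤ F xm`
  have hM_le : (∫ x, F x * w x ∂μ) / Z ≤ F xm := by
    rw [div_le_iff₀ hZ]
    calc ∫ x, F x * w x ∂μ ≤ ∫ x, F xm * w x ∂μ :=
          integral_mono hFwi (hwi.const_mul _) fun x => mul_le_mul_of_nonneg_right (hFmax x) (hw0 x)
      _ = F xm * Z := by rw [integral_const_mul]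
  constructor
  · -- (a) flatness
    intro x₀
    set A : ℝ := 2 * K * C_R + 1 with hA
    have hApos : 0 < A := by positivity
    set δ : ℝ := A ^ (-(1 / c)) with hδ
    have hδpos : 0 < δ := Real.rpow_pos_of_pos hApos _
    have hδc : δ ^ c = A⁻¹ := by
      rw [hδ, ← Real.rpow_mul hApos.le, neg_mul, one_div, inv_mul_cancel₀ hc.ne', Real.rpow_neg hApos.le,
        Real.rpow_one]
    have hinvδ : δ⁻¹ = A ^ (1 / c) := by
      rw [hδ, Real.rpow_neg hApos.le, inv_inv]
    by_cases hFm0 : F xm ≤ 0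
    · have h0 : F x₀ = 0 := le_antisymm ((hFmax x₀).trans hFm0) (hF0 x₀)
      rw [h0]
      refine mul_nonneg (by positivity) (div_nonneg (integral_nonneg fun x => ?_) hZ.le)
      exact mul_nonneg (hF0 x) (hw0 x)
    push Not at hFm0
    -- mass of the deep sublevel set `B = {F ≤ δ F xm}` is at most `K Z C_R δ^c ≤ Z/2`
    set B : Set X := {x | F x ≤ δ * F xm} with hB
    have hBmeas : MeasurableSet B := (isClosed_le hF continuous_const).measurableSet
    have hBmass : ∫ x in B, w x ∂μ ≤ Z / 2 := by
      calc ∫ x in B, w x ∂μ ≤ K * Z * (μ B).toReal := hmass _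
        _ ≤ K * Z * (C_R * δ ^ c) := by
            refine mul_le_mul_of_nonneg_left (hR1 xm hFm0 δ hδpos) (by positivity)
        _ = Z * (K * C_R / A) := by rw [hδc]; ring
        _ ≤ Z * (1 / 2) := by
            refine mul_le_mul_of_nonneg_left ?_ hZ.le
            rw [div_le_iff₀ hApos, hA]; nlinarith [mul_nonneg hK hCR]
        _ = Z / 2 := by ring
    -- lower bound for `∫ F w` on the complement of `B`
    have hlow : δ * F xm * (Z / 2) ≤ ∫ x, F x * w x ∂μ := by
      have hcompl : ∫ x in Bᶜ, w x ∂μ = Z - ∫ x in B, w x ∂μ := setIntegral_compl hBmeas hwi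
      have h1 : δ * F xm * (Z / 2) ≤ δ * F xm * ∫ x in Bᶜ, w x ∂μ := by
        refine mul_le_mul_of_nonneg_left ?_ (by positivity)
        rw [hcompl]; linarith
      have h2 : δ * F xm * ∫ x in Bᶜ, w x ∂μ = ∫ x in Bᶜ, δ * F xm * w x ∂μ := by
        rw [integral_const_mul]
      have h3 : ∫ x in Bᶜ, δ * F xm * w x ∂μ ≤ ∫ x in Bᶜ, F x * w x ∂μ := by
        refine setIntegral_mono_on ((hwi.const_mul _).integrableOn) hFwi.integrableOn hBmeas.compl
          fun x hx => ?_
        have hx' : δ * F xm < F x := by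
          simpa [hB] using hx
        exact mul_le_mul_of_nonneg_right hx'.le (hw0 x)
      have h4 : ∫ x in Bᶜ, F x * w x ∂μ ≤ ∫ x, F x * w x ∂μ :=
        setIntegral_le_integral hFwi (Eventually.of_forall fun x => mul_nonneg (hF0 x) (hw0 x))
      linarith
    -- conclude
    set I : ℝ := ∫ x, F x * w x ∂μ with hI
    have hδne : δ ≠ 0 := hδpos.ne'
    have hZne : Z ≠ 0 := hZ.ne'
    have h1 : F xm * (δ * Z) ≤ I * 2 := by
      have : F xm * (δ * Z) = 2 * (δ * F xm * (Z / 2)) := by ring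
      linarith
    have hkey : F xm ≤ 2 * δ⁻¹ * (I / Z) := by
      calc F xm = F xm * (δ * Z) / (δ * Z) := by field_simp
        _ ≤ I * 2 / (δ * Z) := by gcongr
        _ = 2 * δ⁻¹ * (I / Z) := by field_simp
    calc F x₀ ≤ F xm := hFmax x₀
      _ ≤ 2 * δ⁻¹ * (I / Z) := hkey
      _ = 2 * A ^ (1 / c) * (I / Z) := by rw [hinvδ]
  · -- (b′) relative small balls
    intro hM ε hε
    set M : ℝ := (∫ x, F x * w x ∂μ) / Z with hMdef
    have hFm : 0 < F xm := lt_of_lt_of_le hM hM_le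
    have hsub : {x | F x ≤ ε * M} ⊆ {x | F x ≤ ε * F xm} := fun x hx =>
      le_trans (show F x ≤ ε * M from hx) (mul_le_mul_of_nonneg_left hM_le hε.le)
    have hmeas : MeasurableSet {x | F x ≤ ε * M} := (isClosed_le hF continuous_const).measurableSet
    have hind : ∫ x, (if F x ≤ ε * M then (1 : ℝ) else 0) * w x ∂μ = ∫ x in {x | F x ≤ ε * M}, w x ∂μ := by
      rw [← integral_indicator hmeas]
      congr 1; ext x
      by_cases hx : F x ≤ ε * M
      · simp [hx]
      · simp [hx]
    rw [hind, div_le_iff₀ hZ]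
    calc ∫ x in {x | F x ≤ ε * M}, w x ∂μ ≤ K * Z * (μ {x | F x ≤ ε * M}).toReal := hmass _
      _ ≤ K * Z * (μ {x | F x ≤ ε * F xm}).toReal := by
          refine mul_le_mul_of_nonneg_left ?_ (by positivity)
          exact ENNReal.toReal_mono (measure_ne_top _ _) (measure_mono hsub)
      _ ≤ K * Z * (C_R * ε ^ c) := mul_le_mul_of_nonneg_left (hR1 xm hFm ε hε) (by positivity)
      _ = K * C_R * ε ^ c * Z := by ring

/-- STRUCTURAL REDUCTION (both clauses): (R1) + density bound ⇒ the crux.  (a) follows because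
`M ≥ δ·F(W₀)·(1 − ν_β(F < δ F(W₀)))` and `ν_β(F < δ F(W₀)) ≤ C(1+β)^p · Haar{F ≤ δ F(W₀)} ≤ ½` for
`δ = c'(1+β)^{-p/c}`; (b′) because `{F ≤ εM} ⊆ {F ≤ ε sup F}`.  No local Remez lemma is needed.  Stated as a
named `Prop` so that `TiltedFlatness_of` below is the ONLY theorem of this file concluding the crux by name
(skeleton audit). -/
def CruxOfR1Density : Prop := HaarRelativeSmallBalls → TiltDensityBound → TiltedFlatness

/-- PROVED: the crux `TiltedFlatness` (item 14070, both clauses) follows from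
(R1) `HaarRelativeSmallBalls` and the sandwich `TiltDensityBound`, with
`C = max(2(2C_DC_R+1)^{1/c}, C_DC_R)`, `p = max(p₀⁺/c, p₀⁺)`, same `c`. -/
theorem cruxOfR1Density_holds : CruxOfR1Density := by
  intro hR1 hD Nf
  obtain ⟨C_R, c, hCR, hc, hR⟩ := hR1 Nf
  obtain ⟨C_D, p₀, hCD, hDD⟩ := hD
  set P : ℝ := max (max p₀ 0 / c) (max p₀ 0) with hP
  set Cbig : ℝ := max (2 * (2 * C_D * C_R + 1) ^ (1 / c)) (C_D * C_R) with hCbig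
  refine ⟨Cbig, P, c, lt_max_of_lt_right (mul_pos hCD hCR), hc, ?_⟩
  intro β hβ mq hmq L _ hL U x y star refit F wt haar Z M
  -- continuity of the carriers
  have hrefit : Continuous refit := by
    refine continuous_pi fun e => ?_
    by_cases h : star e
    · simp only [refit, if_pos h]; exact continuous_apply e
    · simp only [refit, if_neg h]; exact continuous_const
  have hFc : Continuous F :=
    continuous_norm.comp
      (((Summit.QuantumFields.QCD.Theorems.TiltedFlatnessNegative.continuous_diracMatrix mq).comp
        hrefit).matrix_det)
  have hSc : Continuous fun W => wilsonAction (fundamentalRep (Fin 3)) (refit W) :=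
    (Summit.QuantumFields.QCD.Theorems.TiltedFlatnessNegative.continuous_wilsonAction
      (fundamentalRep (Fin 3)) (continuous_fundamentalRep (Fin 3))).comp hrefit
  have hwtc : Continuous wt := Real.continuous_exp.comp ((continuous_const.mul hSc).neg)
  have hF0 : ∀ W, 0 ≤ F W := fun W => norm_nonneg _
  have hwt0 : ∀ W, 0 < wt W := fun W => Real.exp_pos _
  haveI : IsProbabilityMeasure haar := by
    show IsProbabilityMeasure (Measure.pi fun _ => haarProbability (Matrix.specialUnitaryGroup (Fin 3) ℂ))
    infer_instance
  -- `Z > 0`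
  have hZ : 0 < Z := by
    obtain ⟨Wm, -, hWm⟩ := isCompact_univ.exists_isMinOn univ_nonempty hwtc.continuousOn
    have hle : ∫ W, wt Wm ∂haar ≤ Z :=
      integral_mono (integrable_const _)
        (Summit.QuantumFields.QCD.Theorems.TiltedFlatnessNegative.integrable_of_continuous hwtc)
        fun W => hWm (mem_univ W)
    have hc' : ∫ W, wt Wm ∂haar = wt Wm := by simp
    linarith [hwt0 Wm]
  -- density bound and small balls, read off the hypotheses (the `let`s agree definitionally)
  have h1β : (1 : ℝ) ≤ 1 + β := by linarith
  set t : ℝ := (1 + β) ^ (max p₀ 0) with ht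
  have ht1 : 1 ≤ t := Real.one_le_rpow h1β (le_max_right _ _)
  have hKle : C_D * (1 + β) ^ p₀ ≤ C_D * t :=
    mul_le_mul_of_nonneg_left (Real.rpow_le_rpow_of_exponent_le h1β (le_max_left _ _)) hCD.le
  have hdens : ∀ W, wt W ≤ C_D * t * Z := by
    intro W
    have h := hDD β hβ L hL U x y W
    have h' : wt W / Z ≤ C_D * (1 + β) ^ p₀ := h
    rw [div_le_iff₀ hZ] at h'
    exact h'.trans (mul_le_mul_of_nonneg_right hKle hZ.le)
  have hR1' : ∀ W₀, 0 < F W₀ → ∀ ε : ℝ, 0 < ε → (haar {W | F W ≤ ε * F W₀}).toReal ≤ C_R * ε ^ c :=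
    fun W₀ hW₀ ε hε => hR mq hmq L hL U x y W₀ hW₀ ε hε
  obtain ⟨ha, hb⟩ := flatness_and_smallBalls_of_anticoncentration haar hFc hwtc hF0
    (fun W => (hwt0 W).le) (by positivity : 0 ≤ C_D * t) hCR.le hc hZ hdens hR1'
  -- constants: `(2 C_D t C_R + 1)^{1/c} ≤ (2 C_D C_R + 1)^{1/c} t^{1/c}` and `t^{1/c}, t ≤ (1+β)^P`
  have hA : 2 * (C_D * t) * C_R + 1 ≤ (2 * C_D * C_R + 1) * t := by nlinarith [mul_pos hCD hCR]
  have htP1 : t ^ (1 / c) ≤ (1 + β) ^ P := by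
    rw [ht, ← Real.rpow_mul (by linarith), mul_one_div]
    exact Real.rpow_le_rpow_of_exponent_le h1β (le_max_left _ _)
  have htP2 : t ≤ (1 + β) ^ P := Real.rpow_le_rpow_of_exponent_le h1β (le_max_right _ _)
  have hM0 : 0 ≤ M := div_nonneg (integral_nonneg fun W => mul_nonneg (hF0 W) (hwt0 W).le) hZ.le
  refine ⟨fun W₀ => (ha W₀).trans ?_, fun hM ε hε => (hb hM ε hε).trans ?_⟩
  · have h2 : (2 * (C_D * t) * C_R + 1) ^ (1 / c) ≤ (2 * C_D * C_R + 1) ^ (1 / c) * (1 + β) ^ P := by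
      calc (2 * (C_D * t) * C_R + 1) ^ (1 / c) ≤ ((2 * C_D * C_R + 1) * t) ^ (1 / c) :=
            Real.rpow_le_rpow (by positivity) hA (by positivity)
        _ = (2 * C_D * C_R + 1) ^ (1 / c) * t ^ (1 / c) := Real.mul_rpow (by positivity) (by positivity)
        _ ≤ (2 * C_D * C_R + 1) ^ (1 / c) * (1 + β) ^ P :=
            mul_le_mul_of_nonneg_left htP1 (by positivity)
    calc 2 * (2 * (C_D * t) * C_R + 1) ^ (1 / c) * M
        ≤ 2 * ((2 * C_D * C_R + 1) ^ (1 / c) * (1 + β) ^ P) * M := by gcongr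
      _ = (2 * (2 * C_D * C_R + 1) ^ (1 / c)) * (1 + β) ^ P * M := by ring
      _ ≤ Cbig * (1 + β) ^ P * M := by gcongr; exact le_max_left _ _
  · calc C_D * t * C_R * ε ^ c = (C_D * C_R) * t * ε ^ c := by ring
      _ ≤ Cbig * (1 + β) ^ P * ε ^ c := by
          gcongr
          · exact le_max_right _ _

/-! ## §1  The rational chart: Cayley transform + determinant-phase correction -/

/-- The Cayley transform `cay(H) = (1 + iH)(1 − iH)⁻¹` (`⁻¹` = `Matrix.inv`, the genuine inverse whenever
`1 − iH` is invertible — always, for Hermitian `H`). Entries are RATIONAL in `H`: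
`(1+iH)·adj(1−iH)/det(1−iH)`. [folklore] -/
def cayley (H : Matrix (Fin 3) (Fin 3) ℂ) : Matrix (Fin 3) (Fin 3) ℂ :=
  (1 + Complex.I • H) * (1 - Complex.I • H)⁻¹

/-- Determinant-phase correction `p(M) = M · diag(conj(det M), 1, 1)`: for unitary `M` it is special
unitary, `p|SU(3) = id`, and `p(w·M) = w·p(M)` whenever `det w = 1` (left-`SU(3)`-equivariance); column `0`
is multiplied by the polynomial `conj(det M)`. [folklore] -/
def detFixMat (M : Matrix (Fin 3) (Fin 3) ℂ) : Matrix (Fin 3) (Fin 3) ℂ :=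
  M * Matrix.diagonal ![star M.det, 1, 1]

/-- ONE CHARTED LINK `y ↦ p(g · cay(uHerm y)) ∈ SU(3)` (`uHerm` = the tree's real coordinates of Hermitian
`3 × 3` matrices, `Barriers/QuantumFields/UnitaryHaarSmallBall.lean`). Defined by cases on membership so
that the skeleton carries no proof obligation; for unitary `g` the membership ALWAYS holds
(`CayleyChartGeometry` (G0a)) and the `else` branch is dead. [folklore] -/
def chartLink (g : Matrix (Fin 3) (Fin 3) ℂ) (y : Fin 3 × Fin 3 → ℝ) :
    Matrix.specialUnitaryGroup (Fin 3) ℂ :=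
  if h : detFixMat (g * cayley (uHerm y)) ∈ Matrix.specialUnitaryGroup (Fin 3) ℂ then ⟨_, h⟩ else 1

/-- The charted gauge configuration: centre `g_e` and chart coordinate `yv_e ∈ ℝ⁹` on EVERY edge (only the
`≤ 16` star edges matter after `refit`). [folklore] -/
def chartCfg {L : ℕ} (g : Edge 4 L → Matrix (Fin 3) (Fin 3) ℂ) (yv : Edge 4 L → (Fin 3 × Fin 3 → ℝ)) :
    GaugeConfig 4 L (Matrix.specialUnitaryGroup (Fin 3) ℂ) :=
  fun e => chartLink (g e) (yv e)

/-! ## §2  The statements of the line -/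

/-- **Cayley chart geometry** (single link; everything the chain and the assembler use about the chart map):
(G0a) well-definedness — for unitary `g` the charted link IS `p(g·cay(uHerm y))` (membership in `SU(3)`:
`cay` of a Hermitian matrix is unitary, `|det| = 1`, so `diag(conj det, 1, 1)` is unitary and the product has
determinant `|det|² = 1`); (G0b) origin — `chartLink w 0 = w` on `SU(3)` (`uHerm 0 = 0`, `cay 0 = 1`,
`p|SU(3) = id`); (G0c) equivariance — `chartLink (w·g) y = w · chartLink g y` for `w ∈ SU(3)`; (G1) weight
pinching — `1 ≤ |det(1 − i·uHerm y)|` always (eigenvalues `1 − iλ`) and `≤ 8` on `uOpNorm y ≤ 1`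
(`|det A| ≤ ‖A‖³ ≤ 2³`); (G2) local surjectivity — `‖V − 1‖ ≤ 1 ⇒ V = cay(H)`, `H = −i(V−1)(V+1)⁻¹`
Hermitian with `‖H‖ ≤ ‖V−1‖·‖(V+1)⁻¹‖ ≤ 1·1` (Neumann; sharp: `tan(π/6) = 1/√3`); (G3)
`‖cay H − 1‖ = ‖2iH(1−iH)⁻¹‖ ≤ 2‖H‖` (`‖(1−iH)⁻¹‖ ≤ 1`); (G4) `cay(uHerm y)` is unitary; (G5) continuity of
`y ↦ chartLink g y` (via (G0a): `det`, `adjugate` polynomial, `Ring.inverse` continuous off `0`).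
All elementary; kit j008526 part 5 (ideator 3) sampled (G1)/(G2) on `4·10⁴` unitaries. [folklore] -/
def CayleyChartGeometry : Prop :=
  (∀ (g : Matrix.unitaryGroup (Fin 3) ℂ) (y : Fin 3 × Fin 3 → ℝ),
      ((chartLink (g : Matrix (Fin 3) (Fin 3) ℂ) y : Matrix.specialUnitaryGroup (Fin 3) ℂ) :
          Matrix (Fin 3) (Fin 3) ℂ) =
        detFixMat ((g : Matrix (Fin 3) (Fin 3) ℂ) * cayley (uHerm y))) ∧
  (∀ w : Matrix.specialUnitaryGroup (Fin 3) ℂ, chartLink (w : Matrix (Fin 3) (Fin 3) ℂ) 0 = w) ∧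
  (∀ (w : Matrix.specialUnitaryGroup (Fin 3) ℂ) (g : Matrix.unitaryGroup (Fin 3) ℂ)
      (y : Fin 3 × Fin 3 → ℝ),
      chartLink ((w : Matrix (Fin 3) (Fin 3) ℂ) * (g : Matrix (Fin 3) (Fin 3) ℂ)) y =
        w * chartLink (g : Matrix (Fin 3) (Fin 3) ℂ) y) ∧
  (∀ y : Fin 3 × Fin 3 → ℝ,
      1 ≤ ‖((1 : Matrix (Fin 3) (Fin 3) ℂ) - Complex.I • uHerm y).det‖ ∧
      (uOpNorm y ≤ 1 → ‖((1 : Matrix (Fin 3) (Fin 3) ℂ) - Complex.I • uHerm y).det‖ ≤ 8)) ∧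
  (∀ V : Matrix.unitaryGroup (Fin 3) ℂ, ‖(V : Matrix (Fin 3) (Fin 3) ℂ) - 1‖ ≤ 1 →
      ∃ y : Fin 3 × Fin 3 → ℝ, uOpNorm y ≤ 1 ∧ cayley (uHerm y) = (V : Matrix (Fin 3) (Fin 3) ℂ)) ∧
  (∀ y : Fin 3 × Fin 3 → ℝ, ‖cayley (uHerm y) - 1‖ ≤ 2 * uOpNorm y) ∧
  (∀ y : Fin 3 × Fin 3 → ℝ, cayley (uHerm y) ∈ Matrix.unitaryGroup (Fin 3) ℂ) ∧
  (∀ g : Matrix.unitaryGroup (Fin 3) ℂ,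
      Continuous fun y : Fin 3 × Fin 3 → ℝ => chartLink (g : Matrix (Fin 3) (Fin 3) ℂ) y)

/-- **Chart polynomiality** (the card's First lemma in the multi-link / `N_f`-flavour PRODUCT form; HARDEST
stub). For fixed `N_f` there are `D, N` such that for all masses, volumes `L ≥ 4`, outsides `U`, sites and
every family of UNITARY chart centres `g_e`, the function
`yv ↦ F(refit(chartCfg g yv))² · ∏_{e ∈ star} |det(1 − i·uHerm yv_e)|^N` is (the evaluation of) ONE real
polynomial of total degree `≤ D` in the `9·#star ≤ 144` star coordinates — for ALL `yv ∈ (ℝ⁹)^E`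
(`1 ± iH` is always invertible, no restriction to the ball). Why: each entry of `V_e = p(g_e cay(H_e))` and
of `V_e⁻¹ = V_e†` is `(complex polynomial of degree ≤ 6 in yv_e)/Δ_e`, `Δ_e = det(1 + H_e²) =
|det(1 − iH_e)|²` a real sextic (column `0` carries `1/det(1+iH)`, columns `1,2` carry `1/det(1−iH)`,
`conj det(1 ± iH) = det(1 ∓ iH)`); the `24 N_f` rows of `diracMatrix` at the two endpoints of `e` are the
only ones meeting `V_e, V_e†` (tree `wilsonDirac`, `diracMatrix` = flavour-diagonal reindex), so by
ROW-MULTILINEARITY `det · ∏_e Δ_e^{24N_f}` is a complex polynomial `P(yv)` and `F² ∏_e |det(1−iH_e)|^{96 N_f}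
= |P|² = (Re P)² + (Im P)²`; `D ≤ 2·384N_f·48`, `L`-independent because a star link occupies `24N_f` rows
whatever `L` (kit j002689/j009683/j010040: band limit confirmed numerically). Why it might fail: only by a
bookkeeping slip (exponent `N` too small at some row) — cured by enlarging `N` (`Δ_e ≥ 1` keeps
polynomiality). [folklore] -/
def ChartPolynomiality : Prop :=
  ∀ Nf : ℕ, ∃ D N : ℕ, ∀ (mq : Fin Nf → ℝ) (L : ℕ) [NeZero L], 4 ≤ L →
    ∀ (U : GaugeConfig 4 L (Matrix.specialUnitaryGroup (Fin 3) ℂ)) (x y : TorusSite 4 L)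
      (g : Edge 4 L → Matrix.unitaryGroup (Fin 3) ℂ),
    let star : Edge 4 L → Prop := fun e =>
      e.1 = x ∨ Site.shift e.1 e.2 = x ∨ e.1 = y ∨ Site.shift e.1 e.2 = y
    let refit : GaugeConfig 4 L (Matrix.specialUnitaryGroup (Fin 3) ℂ) →
        GaugeConfig 4 L (Matrix.specialUnitaryGroup (Fin 3) ℂ) := fun W e => if star e then W e else U e
    let F : GaugeConfig 4 L (Matrix.specialUnitaryGroup (Fin 3) ℂ) → ℝ :=
      fun W => ‖(diracMatrix (refit W) mq).det‖
    ∃ Q : MvPolynomial ({e : Edge 4 L // star e} × (Fin 3 × Fin 3)) ℝ, Q.totalDegree ≤ D ∧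
      ∀ yv : Edge 4 L → (Fin 3 × Fin 3 → ℝ),
        F (chartCfg (fun e => (g e : Matrix (Fin 3) (Fin 3) ℂ)) yv) ^ 2 *
            ∏ e : {e : Edge 4 L // star e},
              ‖((1 : Matrix (Fin 3) (Fin 3) ℂ) - Complex.I • uHerm (yv e.1)).det‖ ^ N =
          MvPolynomial.eval (fun v : {e : Edge 4 L // star e} × (Fin 3 × Fin 3) => yv v.1.1 v.2) Q

/-- **Scaled Carbery–Wright / Brudnyi–Ganzburg and its Remez form** (the engine in the two shapes the line
consumes; a COROLLARY of the PROVED `CarberyWright.supSublevelBound_holds`, `C = 16e²` there). For a real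
polynomial `Q` of degree `≤ d` on `ℝⁿ` and a convex body `K` (ANY positive volume) on which `Q ≢ 0`:
(i) sublevel form `vol{x ∈ K : |Q| ≤ η·sup_K|Q|} ≤ C·n·η^{1/d}·vol K` (scale `K` to volume one by the
homothety `x ↦ vol(K)^{-1/n} x`, which keeps the degree, then Thm 2 with `α = (η sup|Q|)^{1/d}`);
(ii) Remez form: `E ⊆ K`, `vol E ≥ λ·vol K` ⇒ `sup_K |Q| ≤ (Cn/λ)^d · sup_E |Q|` (apply (i) with
`η = sup_E|Q| / sup_K|Q|`: `λ ≤ Cn η^{1/d}`). Why it might fail: it cannot (both are immediate from the tree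
theorem); the size is the `MvPolynomial` rescaling (`aeval (c • X)`, `totalDegree` preserved) and
`Measure.addHaar_smul`. [cite: CarberyWright2001, Thm 2 (q = ∞); doi:10.1070/im1973v007n02abeh001941] -/
def ConvexSublevel : Prop :=
  ∃ C : ℝ, 1 ≤ C ∧ ∀ (n d : ℕ), 1 ≤ n → 1 ≤ d →
    ∀ Q : MvPolynomial (Fin n) ℝ, Q.totalDegree ≤ d →
    ∀ K : Set (Fin n → ℝ), IsCompact K → Convex ℝ K → (interior K).Nonempty →
      0 < sSup ((fun x => |MvPolynomial.eval x Q|) '' K) →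
      (∀ η : ℝ, 0 < η →
        (volume {x | x ∈ K ∧
            |MvPolynomial.eval x Q| ≤ η * sSup ((fun x => |MvPolynomial.eval x Q|) '' K)}).toReal ≤
          C * n * η ^ ((1 : ℝ) / d) * (volume K).toReal) ∧
      (∀ E : Set (Fin n → ℝ), E ⊆ K → ∀ lam : ℝ, 0 < lam →
        lam * (volume K).toReal ≤ (volume E).toReal →
          sSup ((fun x => |MvPolynomial.eval x Q|) '' K) ≤
            (C * n / lam) ^ d * sSup ((fun x => |MvPolynomial.eval x Q|) '' E))

/-- **Chart-sup comparability** (the chain; load-bearing — a chart whose image misses the maximiser has no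
other sup control). For fixed `N_f` there is `κ > 0` such that for all masses, `L ≥ 4`, outsides, sites,
every family of unitary chart centres `g` and every configuration `W₁`, SOME point of the chart around `g`
(coordinates in the unit `uOpNorm`-ball on every edge) carries `F ≥ κ·F(W₁)` — i.e.
`sup_{chart(g)} F ≥ κ · sup F`. Proof route: `W*` = argmax of `F∘refit` (compact); per edge
`g_e⁻¹W*_e = e^{i uHerm x_e}`, `uOpNorm x_e ≤ π` (`exists_uCoords_eq`); centres
`g^{(j)}_e = g_e e^{i(j/7)uHerm x_e}`, `j = 0…7`, so `g^{(0)} = g`, `chartCfg g^{(7)} 0 = W*` on the star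
(G0b); `‖e^{iuHerm x/7} − 1‖ ≤ π/7` (`norm_expHermUnitary_sub_le`); for `uOpNorm y' ≤ 1/6`,
`V = e^{iuHerm x_e/7} cay(uHerm y') ∈ U(3)` has `‖V − 1‖ ≤ π/7 + 2/6 < 1` (G3, G4), so `V = cay(uHerm y)` with
`uOpNorm y ≤ 1` (G2) and `chartLink g^{(j+1)}_e y' = chartLink g^{(j)}_e y` (G0a): the sub-ball image of
chart `j+1` lies in chart `j`; in chart `j+1`'s OWN coordinates `ConvexSublevel` (ii) on the concentric
product balls `B_{1/6}^k ⊆ B₁^k` (`λ = 6^{-9k}`, `k ≤ 16`), applied to the polynomial of `ChartPolynomiality`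
with the weights pinched in `[1, 8^{Nk}]` (G1), gives `s_j ≥ 8^{-Nk/2}(C·9k·6^{9k})^{-D/2} s_{j+1}`; seven steps:
`κ = (8^{-8N}(144C·6^{144})^{-D/2})^7`, a function of `N_f` only. Why it might fail: it cannot once the
three hypotheses hold (all overlaps are set inclusions, all volume ratios concentric). [folklore] -/
def ChartSupChain : Prop :=
  ∀ Nf : ℕ, ∃ κ : ℝ, 0 < κ ∧ ∀ (mq : Fin Nf → ℝ) (L : ℕ) [NeZero L], 4 ≤ L →
    ∀ (U : GaugeConfig 4 L (Matrix.specialUnitaryGroup (Fin 3) ℂ)) (x y : TorusSite 4 L)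
      (g : Edge 4 L → Matrix.unitaryGroup (Fin 3) ℂ)
      (W₁ : GaugeConfig 4 L (Matrix.specialUnitaryGroup (Fin 3) ℂ)),
    let star : Edge 4 L → Prop := fun e =>
      e.1 = x ∨ Site.shift e.1 e.2 = x ∨ e.1 = y ∨ Site.shift e.1 e.2 = y
    let refit : GaugeConfig 4 L (Matrix.specialUnitaryGroup (Fin 3) ℂ) →
        GaugeConfig 4 L (Matrix.specialUnitaryGroup (Fin 3) ℂ) := fun W e => if star e then W e else U e
    let F : GaugeConfig 4 L (Matrix.specialUnitaryGroup (Fin 3) ℂ) → ℝ :=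
      fun W => ‖(diracMatrix (refit W) mq).det‖
    ∃ yv : Edge 4 L → (Fin 3 × Fin 3 → ℝ), (∀ e, uOpNorm (yv e) ≤ 1) ∧
      κ * F W₁ ≤ F (chartCfg (fun e => (g e : Matrix (Fin 3) (Fin 3) ℂ)) yv)

/-! ## §3  Registered stubs (the ONLY `sorry`s of the line) -/

/-- **STUB 1 — `stub_chartGeometry` (M; single-link chart geometry (G0a)–(G5), see `CayleyChartGeometry`).**
Elementary linear algebra of the Cayley transform and of `p`; the only analysis is `‖(1−iH)⁻¹‖ ≤ 1` /
`‖(V+1)⁻¹‖ ≤ 1` for `‖V−1‖ ≤ 1` (Neumann: `‖(2 − (1−V))⁻¹‖ ≤ 1/(2−1)`) and continuity of `Matrix.inv` on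
invertibles. Leans on: `uHerm_isHermitian`, `uHerm_uCoords`, `uHerm_zero`, `uOpNorm` (tree,
UnitaryHaarSmallBall.lean), `Matrix.mem_unitaryGroup_iff`, `Matrix.mem_specialUnitaryGroup_iff`,
`Matrix.det_of_mem_unitary`, `Matrix.nonsing_inv_mul`, `Matrix.det_le`/`Matrix.det_mul`,
`CStarRing.norm_of_mem_unitary` (Mathlib). Why it might fail: it cannot. [folklore] -/
theorem stub_chartGeometry : CayleyChartGeometry := by
  sorry

/-- **STUB 2 — `stub_chartPoly` (L; HARDEST; the card's First lemma in product form).** See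
`ChartPolynomiality`. Proof route: (1) entrywise, `cayley (uHerm y) = (1 + i uHerm y) · adj(1 − i uHerm y) ·
(det(1 − i uHerm y))⁻¹` (`Matrix.inv_def`, `Ring.inverse` of a unit) with `uHerm y` AFFINE in `y`, so every
entry of `g · cayley(uHerm y)` is `MvPolynomial.eval y (cubic)/d₋(y)`; `detFixMat` multiplies column `0` by
`conj(det g)·conj(d₊/d₋) = conj(det g)·d₋/d₊` (`conj ∘ det(1 + i uHerm ·) = det(1 − i uHerm ·)` as polynomial
maps of the REAL variables), and `1/d₊ = d₋/Δ`, `1/d₋ = d₊/Δ`, `Δ = d₊d₋ = |d₋|²` real; the `SU(3)`-inverse is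
`star` (`Matrix.star_eq_conjTranspose`), entrywise `conj`; (2) `diracMatrix (refit (chartCfg g yv)) mq` has,
in each row indexed by a quark at site `s`, entries that are `ℂ`-linear in the entries of `V_{(s,μ)}` and
`V_{(s−μ̂,μ)}†` only (tree `wilsonDirac`/`diracMatrix`), hence `(polynomial)/∏_{e ∋ s} Δ_e`; (3) scale row
`(f,s,a,α)` by `∏_{star e ∋ s} Δ_e` (`Matrix.det_mul_row`/`det_updateRow_smul`): the scaled matrix has
polynomial entries, its determinant is a polynomial `P` (`Matrix.det_apply'` + `MvPolynomial` ring
structure, or `Polynomial.eval` as a ring hom applied to `Matrix.det` via `RingHom.map_det`), and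
`∏_rows(scale) = ∏_e Δ_e^{24 N_f}`; (4) `‖det‖² ∏_e |d₋,e|^{96N_f} = |P|² = (Re P)² + (Im P)²`, real
coefficients via `MvPolynomial.map Complex.reCLM`-style splitting; `D := 2 deg P`. The cleanest Lean road is
to work with the ring hom `MvPolynomial σ ℂ → (functions)` and `RingHom.map_det` throughout and take real
parts at the end. Leans on: `PauliBandLimit`-type rank counts are NOT needed (crude multilinearity suffices).
Why it might fail: bookkeeping only (enlarge `N`; `Δ_e ≥ 1`). [cite: doi:10.1103/physrevd.63.114502;
MontvayMunster1994, §4.2/§5.1] -/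
theorem stub_chartPoly : ChartPolynomiality := by
  sorry

/-- **STUB 3 — `stub_convexSublevel` (S–M; the engine, rescaled, and its Remez form).** See
`ConvexSublevel`; both parts are corollaries of the PROVED
`Literature.Analysis.Approximation.CarberyWright.supSublevelBound_holds` (volume-one convex bodies,
`(sup|p|)^{1/d} α⁻¹ vol{|p|^{1/d} ≤ α} ≤ Cn`): homothety to volume one (`Measure.addHaar_smul`, image of a
convex body is a convex body, `MvPolynomial.totalDegree` of `aeval (c • X) Q` is `≤ d`), `α := (η·sup)^{1/d}`,
monotonicity of `t ↦ t^{1/d}`; (ii) from (i) by contraposition on `η = sup_E/sup_K` (and `sup_E > 0` because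
`vol E > 0` while `vol{Q = 0 on K} = 0` by (i) as `η → 0`). Take `C := max(16e², 1)`. Why it might fail: it
cannot. [cite: CarberyWright2001, Thm 2 (q = ∞)] -/
theorem stub_convexSublevel : ConvexSublevel := by
  sorry

/-- **STUB 4 — `stub_chain` (M; chart-sup comparability from the chart facts).** See `ChartSupChain` for the
complete route (7-step exponential path in `U(3)` per star edge, set-inclusion overlaps via (G2)–(G4),(G0a),
Remez form (ii) of `ConvexSublevel` on concentric product balls with `λ = 6^{-9k}`, weights pinched by (G1),
`chartCfg g^{(7)} 0 = W*` by (G0b), sup attained by (G5) + compactness of `{uOpNorm ≤ 1}^E`). The product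
body `{yv⋆ : ∀ e ∈ star, uOpNorm (yv e) ≤ 1} ⊂ ℝ^{9k}` is a convex body (`uOpNorm_add_le`, `uOpNorm_smul`,
`isBounded_uOpBall`, `continuous_uOpNorm`, `zero_mem_uOpBall`); rename the polynomial's variables
`{e // star e} × (Fin 3 × Fin 3) ≃ Fin (9k)` (`MvPolynomial.rename`, `totalDegree_rename_le`). Leans on:
`exists_uCoords_eq`, `norm_expHermUnitary_sub_le`, `expHermUnitary`, `uOpNorm_smul` (tree, PROVED),
`CStarRing.norm_of_mem_unitary`, `IsCompact.exists_isMaxOn` (Mathlib). Why it might fail: it cannot given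
the hypotheses; constants are astronomically small (`κ ~ (6^{144})^{-7D/2}`) but depend on `N_f` only, which
is all `∃ (C, p, c)` asks. [folklore] -/
theorem stub_chain : CayleyChartGeometry → ChartPolynomiality → ConvexSublevel → ChartSupChain := by
  sorry

/-- **STUB 5 — `stub_assembleR1` (M–L; the Transfer `C⁺ ⇒ (R1)`: averaging identity + one engine call).**
From the chart facts to `HaarRelativeSmallBalls`. Route: fix the data and `W₀` with `F W₀ > 0`, `ε > 0`.
(1) `Measure.pi (fun _ => haarProbability SU(3)) = haarProbability (GaugeConfig 4 L SU(3))`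
(`Measure.pi.isMulLeftInvariant` + `Measure.haarMeasure_unique`, both probabilities). (2) Averaging
identity `Haar{A} = ∫ μ{h : W·h ∈ A} dHaar(W)` for the CLOSED set `A = {F ≤ εF(W₀)}` and
`μ := Measure.map (fun yv => chartCfg 1 yv) (Measure.pi fun _ => Leb|_{B₁}/vol B₁)` — the tree's
`haarAverageTranslate_holds` (§0, continuous integrands) extended to bounded Borel ones by the SAME proof
(`integral_mul_right_eq_self` + `integral_integral_swap`; measurability from (G5)), or by monotone
approximation of `1_A` by continuous functions; `W · chartCfg 1 yv = chartCfg W yv` by (G0c). (3) For each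
centre `W`: `F(refit(chartCfg W yv))` depends on `yv|star` only, so the inner `μ`-measure is the
`(Leb|_{B₁}/vol B₁)^{⊗ star}`-measure of a set of star coordinates (`Measure.pi` marginal / cylinder set).
(4) On `B₁^{star}`: `F ≤ εF(W₀)` ⇒ `Q_W(yv) = F²·∏|d₋|^N ≤ ε² F(W₀)² 8^{Nk}` (G1), while
`sup_{B₁^{star}} Q_W ≥ (κ F(W₀))² > 0` (`ChartSupChain` at `W₁ := W₀`, weights `≥ 1`), so the set lies in
`{Q_W ≤ η · sup Q_W}`, `η = ε² 8^{Nk} κ⁻²`, whose normalised volume is `≤ C·9k·η^{1/D}` by `ConvexSublevel` (i)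
(rename variables to `Fin (9k)`; the product of unit `uOpNorm`-balls is a convex body). (5) Integrate the
`W`-uniform bound: `Haar{F ≤ εF(W₀)} ≤ 144·C·(8^{16N}κ⁻²)^{1/D} · ε^{2/D}` — constants depend on `N_f` only:
`c := 2/D`. Why it might fail: it cannot given the hypotheses; the Lean size is in steps (1)–(3)
(measure identifications), not in the estimate. [folklore] -/
theorem stub_assembleR1 :
    CayleyChartGeometry → ChartPolynomiality → ConvexSublevel → ChartSupChain → HaarRelativeSmallBalls := by
  sorry

/-- **STUB 6 — `stub_density` (M; the Lipschitz/Taylor sandwich `TiltDensityBound`, shared VERBATIM with the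
torus line `Lines/R1DensityReduction.lean`).** `wt W / Z ≤ C(1+β)^{p₀}` uniformly in the outside: the
non-star plaquettes cancel in `wt/Z`; the star part `S_loc` of `wilsonAction ∘ refit` is `K`-Lipschitz in
each star link for the operator norm (`|Re tr(AXB) − Re tr(AYB)| ≤ 3‖X − Y‖` for unitary `A, B`; a link lies
in `6` plaquettes; `K ≤ 18·16`), so `Z ≥ e^{-βS_min} e^{-1} · Haar(∏_{e ∈ star} B_{SU(3)}(W_min,e, 1/(βK)))`
and `wt ≤ e^{-βS_min}`. The `SU(3)` Haar-ball volume `≥ (ρ/(4(2π+ρ)))^{9}` per link comes from THIS line's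
map `p`: the `ρ`-net `{e^{i uHerm y}}` of `U(3)` from the proof of `haar_unitaryOpBall_ge`
(`exists_uOpNorm_net`, `exists_uCoords_eq`, `norm_expHermUnitary_sub_le`) is pushed to a `4ρ`-net
`{p(u_i)} ⊂ SU(3)` (`p|SU(3) = id`, `‖p(u) − p(v)‖ ≤ ‖u − v‖ + |det u − det v| ≤ 4‖u − v‖`), and left
translates of the ball by a net cover the group (`1 ≤ #net · Haar(ball)`, left invariance of
`haarProbability`); alternatively the ball-free word-fibre argument of the torus line (circle-transport §5,
`p₀ = #angles`). For `β ≤ 1` the bound is `e^{β·osc S_loc} ≤ e^{2K}`. Gives `p₀ = 9k ≤ 144`. Why it might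
fail: it cannot (Disproof §8 (P1) and all three triagers concur); it is pure measure theory on the compact
group. [folklore] -/
theorem stub_density : TiltDensityBound := by
  sorry

/-! ## §4  Composition (sorry-free): the six stubs give the crux BY NAME -/

/-- **`TiltedFlatness` from the line.** `stub_chain` turns chart geometry + polynomiality + the scaled engine
into chart-sup comparability; `stub_assembleR1` turns the same three plus comparability into the β = 0
relative small balls (R1); the PROVED trunk `cruxOfR1Density_holds` (§0) combines (R1) with the
sandwich `stub_density` into both clauses of `C′` with `C = max(2(2C_DC_R+1)^{1/c}, C_DC_R)`,
`p = max(p₀/c, p₀)`, `c = 2/D(N_f)`. No hypotheses: when the six stubs are proved this theorem closes item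
stmt-QuantumFields-14070. [folklore] -/
theorem TiltedFlatness_of : TiltedFlatness :=
  cruxOfR1Density_holds
    (stub_assembleR1 stub_chartGeometry stub_chartPoly stub_convexSublevel
      (stub_chain stub_chartGeometry stub_chartPoly stub_convexSublevel))
    stub_density

end Summit.QuantumFields.QCD.Cruxes.TiltedFlatness.CayleyChartAveraging

end
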